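import Summits.CriticalPhenomena.PercolationContinuityZ3.Theorems.Transplant.FKConnectivityAllQAntipodalRootFormRealDefs
import Summits.CriticalPhenomena.PercolationContinuityZ3.Theorems.Transplant.FKConnectivityAllQAntipodalMajMixNested
import HarnessLib

/-!
# Connectivity correlation inequalities for `φ_{w,q}`, every `q > 0` — ROOT-FORM CALCULUS, file 61n: the ROOT IDENTITY
# (the levelwise `maj₃` form of a host `x ∥ 𝓔` is minus the root functional of the real environment of `𝓔`)

Support file (`--supports stmt-CriticalPhenomena-4575`), FK sub-lane `prim-bschramm-fk-2` (gen 29); builds on p205010 (kernel theorem,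
internal audit signed; external expert review pending).  No definitions, no named facts, no sorries; standard axioms.  Memo
FROM-fk-2-g28-ROOT-FORM.md §1, §7 (L4c); FK-Q2 §37–§38.

Let `𝓔` be an edge set with poles `a, b`, special edges `y, z`, cell `M` (free) / `C` (contracted), and let the host be `H = x ∥ 𝓔` with the
root `x = ab` a further free special edge.  For `g` increasing and blind to `x, y, z`, the level-`J` partial sum of the antipodal form of
`maj₃(ω_x, ω_y, ω_z)` against `g` on the cell `(M ∪ {x,y,z}, C)` equals `−M_𝓔(ĝ; J+1)` where `M_𝓔(h; J) = Mt (realEnv M C a b y z) h h J` is the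
root functional of file 61a at the real environment of file 61k and `ĝ(β) = g(β ∪ C) − g((M \ β) ∪ C)` (`FK.RootForm.host_root_identity`:
the root's state contributes its pole bit to the level, `FK.apExpC_insert_root_live₁/₂`; the eight patterns of `(x, y, z)` regroup into the
two slots, `EDat.slot_sum`).  The increment `ĝ` is monotone but signed; since the real environment is antisymmetric under
`β ↦ M \ β` (replicas swapped, patterns complemented: `realEnv_slotSum_compl`) the root functional does not see an added constant
(`Mt_realEnv_add_const`), so `M_𝓔(ĝ) = M_𝓔(ĝ + c)` with `ĝ + c ≥ 0`.  Hence **`FK.RootForm.maj3_levels_le_nonpos_of_rootFact`**: if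
`M_𝓔(h; J) ≥ 0` for every monotone nonnegative `h` (fact 1 of the word theorem for `𝓔`), then every level partial sum of the `maj₃` form of
`x ∥ 𝓔` is `≤ 0` — i.e. `Z_H(z,q)² Cov_{φ_{z,q}}(maj₃, g) ∈ (q−1)·ℝ≥0[z,q]` on that cell.  The sibling files discharge fact 1 for
`𝓔 = B_y ∥ B_z` (THEOREM G27 for real boxes, file 61m) and along spine words.
[cite: Grimmett2006, §1.4 eq. (1.20) (p. 15); §3.8 (pp. 61–62)] [cite: Wagner2006, Thm. 5.8(d), §5.3]
-/

noncomputable section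

namespace Summit.CriticalPhenomena.PercolationContinuityZ3.Theorems

namespace FK

namespace RootForm

open SimpleGraph Finset Literature.Probability.LatticeModels Literature.Probability.Percolation
open scoped Classical

section SlotAlgebra

/-- `[Λ+K¹ ≤ J] − [Λ+K² ≤ J] = [Λ=J]K² − [Λ=J]K¹`. [folklore] -/
theorem PDat.a1_sub_a2 (d : PDat) (J : ℤ) : d.a1 J - d.a2 J = d.r2 J - d.r1 J := by
  obtain ⟨l, k1, k2⟩ := d
  cases k1 <;> cases k2 <;> simp [PDat.a1, PDat.a2, PDat.r1, PDat.r2, ind] <;> split_ifs <;> first | rfl | (exfalso; omega) | norm_num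

/-- The two slots together, without root-exchange terms:
`slot₁ + slot₀ = Σ_b [Λ_∅+K^b ≤ J] − Σ_b [Λ_yz+K^b ≤ J] − ([Λ_y+K¹≤J] − [Λ_y+K²≤J]) − ([Λ_z+K¹≤J] − [Λ_z+K²≤J])`. [folklore] -/
theorem EDat.slot_sum (e : EDat) (J : ℤ) : e.slot1 J + e.slot0 J =
    e.d0.a1 J + e.d0.a2 J - e.dyz.a1 J - e.dyz.a2 J - (e.dy.a1 J - e.dy.a2 J) - (e.dz.a1 J - e.dz.a2 J) := by
  rw [PDat.a1_sub_a2, PDat.a1_sub_a2]; simp only [EDat.slot1, EDat.slot0]; ring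

/-- Replica swap with pattern complement negates the slot sum. [folklore] -/
theorem EDat.slot_sum_swap (e e' : EDat) (h0 : e'.d0 = ⟨e.dyz.lam, e.dyz.k2, e.dyz.k1⟩) (hyz : e'.dyz = ⟨e.d0.lam, e.d0.k2, e.d0.k1⟩)
    (hy : e'.dy = ⟨e.dz.lam, e.dz.k2, e.dz.k1⟩) (hz : e'.dz = ⟨e.dy.lam, e.dy.k2, e.dy.k1⟩) (J : ℤ) :
    e'.slot1 J + e'.slot0 J = -(e.slot1 J + e.slot0 J) := by
  rw [EDat.slot_sum, EDat.slot_sum, h0, hyz, hy, hz]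
  simp only [PDat.a1, PDat.a2]
  ring

variable {C : Type*} [Fintype C] [Preorder C]

omit [Preorder C] in
/-- The un-nested root functional. [folklore] -/
theorem Mt_self (E : Env C) (h : C → ℝ) (J : ℤ) : Mt E h h J = ∑ γ, h γ * ((E γ).slot1 J + (E γ).slot0 J) := by
  unfold Mt; exact Finset.sum_congr rfl fun γ _ => by ring

end SlotAlgebra

section RealEnv

variable {V : Type*} [Fintype V] {M C : Finset (Sym2 V)} {a b : V} {y z : Sym2 V}

/-- Pattern data at the complementary replica-1 set: same level, pole bits swapped. [folklore] -/
theorem realPDat_compl {X : Finset (Sym2 V)} (hX : X ⊆ insert y (insert z M)) :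
    realPDat M C a b y z (insert y (insert z M) \ X) =
      ⟨(realPDat M C a b y z X).lam, (realPDat M C a b y z X).k2, (realPDat M C a b y z X).k1⟩ := by
  simp only [realPDat, apExpC, Finset.sdiff_sdiff_eq_self hX, PDat.mk.injEq, and_true]
  push_cast; ring

/-- **Antisymmetry of the real environment**: at `M \ β` the slot sum is minus that at `β` (`y, z ∉ M`). [folklore] -/
theorem realEnv_slotSum_compl (hyM : y ∉ M) (hzM : z ∉ M) (hyz : y ≠ z) (β : ↥M.powerset) (J : ℤ) :
    (realEnv M C a b y z ⟨M \ β.1, Finset.mem_powerset.2 Finset.sdiff_subset⟩).slot1 J +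
        (realEnv M C a b y z ⟨M \ β.1, Finset.mem_powerset.2 Finset.sdiff_subset⟩).slot0 J =
      -((realEnv M C a b y z β).slot1 J + (realEnv M C a b y z β).slot0 J) := by
  have hX : β.1 ⊆ M := Finset.mem_powerset.1 β.2
  have hyX : y ∉ β.1 := fun h => hyM (hX h)
  have hzX : z ∉ β.1 := fun h => hzM (hX h)
  have hyzM : y ∉ insert z M := by rw [Finset.mem_insert, not_or]; exact ⟨hyz, hyM⟩
  have hyzX : y ∉ insert z β.1 := by rw [Finset.mem_insert, not_or]; exact ⟨hyz, hyX⟩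
  have s0 : M \ β.1 = insert y (insert z M) \ insert y (insert z β.1) := by
    rw [Finset.insert_sdiff_insert, Finset.sdiff_insert_of_notMem hyzM, Finset.insert_sdiff_insert, Finset.sdiff_insert_of_notMem hzM]
  have sy : insert y (M \ β.1) = insert y (insert z M) \ insert z β.1 := by
    rw [Finset.insert_sdiff_of_notMem _ hyzX, Finset.insert_sdiff_insert, Finset.sdiff_insert_of_notMem hzM]
  have sz : insert z (M \ β.1) = insert y (insert z M) \ insert y β.1 := by
    rw [Finset.insert_sdiff_insert, Finset.sdiff_insert_of_notMem hyzM, Finset.insert_sdiff_of_notMem _ hzX]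
  have syz : insert y (insert z (M \ β.1)) = insert y (insert z M) \ β.1 := by
    rw [Finset.insert_sdiff_of_notMem _ hyX, Finset.insert_sdiff_of_notMem _ hzX]
  refine EDat.slot_sum_swap (realEnv M C a b y z β) _ ?_ ?_ ?_ ?_ J
  · show realPDat M C a b y z (M \ β.1) = _
    rw [s0]; exact realPDat_compl (Finset.insert_subset_insert _ (Finset.insert_subset_insert _ hX))
  · show realPDat M C a b y z (insert y (insert z (M \ β.1))) = _
    rw [syz]; exact realPDat_compl (hX.trans ((Finset.subset_insert _ _).trans (Finset.subset_insert _ _)))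
  · show realPDat M C a b y z (insert y (M \ β.1)) = _
    rw [sy]; exact realPDat_compl (Finset.insert_subset_iff.2 ⟨Finset.mem_insert_of_mem (Finset.mem_insert_self _ _),
      hX.trans ((Finset.subset_insert _ _).trans (Finset.subset_insert _ _))⟩)
  · show realPDat M C a b y z (insert z (M \ β.1)) = _
    rw [sz]; exact realPDat_compl (Finset.insert_subset_insert _ (hX.trans (Finset.subset_insert _ _)))

/-- **The root functional of a real environment does not see added constants** (`M(h + c) = M(h)`): the slot sums cancel in complementary
pairs. [folklore] -/
theorem Mt_realEnv_add_const (hyM : y ∉ M) (hzM : z ∉ M) (hyz : y ≠ z) (h : ↥M.powerset → ℝ) (c : ℝ) (J : ℤ) :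
    Mt (realEnv M C a b y z) (fun β => h β + c) (fun β => h β + c) J = Mt (realEnv M C a b y z) h h J := by
  rw [Mt_self, Mt_self]
  have hzero : ∑ β : ↥M.powerset, ((realEnv M C a b y z β).slot1 J + (realEnv M C a b y z β).slot0 J) = 0 := by
    set S : ↥M.powerset → ℝ := fun β => (realEnv M C a b y z β).slot1 J + (realEnv M C a b y z β).slot0 J with hS
    let φ : ↥M.powerset ≃ ↥M.powerset :=
      { toFun := fun β => ⟨M \ β.1, Finset.mem_powerset.2 Finset.sdiff_subset⟩
        invFun := fun β => ⟨M \ β.1, Finset.mem_powerset.2 Finset.sdiff_subset⟩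
        left_inv := fun β => Subtype.ext (Finset.sdiff_sdiff_eq_self (Finset.mem_powerset.1 β.2))
        right_inv := fun β => Subtype.ext (Finset.sdiff_sdiff_eq_self (Finset.mem_powerset.1 β.2)) }
    have hflip : ∑ β, S β = ∑ β, S (φ β) := (Equiv.sum_comp φ S).symm
    have hneg : ∀ β, S (φ β) = -S β := fun β => realEnv_slotSum_compl hyM hzM hyz β J
    simp only [hneg, Finset.sum_neg_distrib] at hflip
    linarith
  have : ∑ β : ↥M.powerset, (h β + c) * ((realEnv M C a b y z β).slot1 J + (realEnv M C a b y z β).slot0 J) =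
      ∑ β : ↥M.powerset, h β * ((realEnv M C a b y z β).slot1 J + (realEnv M C a b y z β).slot0 J) +
        c * ∑ β : ↥M.powerset, ((realEnv M C a b y z β).slot1 J + (realEnv M C a b y z β).slot0 J) := by
    rw [Finset.mul_sum, ← Finset.sum_add_distrib]; exact Finset.sum_congr rfl fun β _ => by ring
  rw [this, hzero, mul_zero, add_zero]

end RealEnv

section RootIdentity

variable {V : Type*} [Fintype V] {M C : Finset (Sym2 V)} {a b uy vy uz vz : V}

/-- level bookkeeping of the root edge: `e + 1 = l + 1{p}` turns `e ≤ J` into `l + 1{p} ≤ J + 1`. [folklore] -/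
theorem root_le_iff {e l J : ℕ} {p : Prop} [Decidable p] (h : e + 1 = l + (if p then 1 else 0)) :
    e ≤ J ↔ (l : ℤ) + (if p then 1 else 0) ≤ (J : ℤ) + 1 := by
  by_cases hp : p <;> simp only [hp, if_true, if_false] at h ⊢ <;> omega

omit [Fintype V] in
/-- Expanding a sum over the configurations of `M ∪ {x, y, z}` by the eight patterns of the three specials. [folklore] -/
theorem sum_powerset_insert₃ {x y z : Sym2 V} (hx : x ∉ insert y (insert z M)) (hy : y ∉ insert z M) (hz : z ∉ M)
    (F : Finset (Sym2 V) → ℝ) :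
    ∑ γ ∈ (insert x (insert y (insert z M))).powerset, F γ =
      ∑ X ∈ M.powerset, (F X + F (insert z X) + (F (insert y X) + F (insert y (insert z X))) +
        (F (insert x X) + F (insert x (insert z X)) + (F (insert x (insert y X)) + F (insert x (insert y (insert z X)))))) := by
  rw [Finset.sum_powerset_insert hx, Finset.sum_powerset_insert hy, Finset.sum_powerset_insert hz, Finset.sum_powerset_insert hy,
    Finset.sum_powerset_insert hz, Finset.sum_powerset_insert hz, Finset.sum_powerset_insert hz]
  simp only [← Finset.sum_add_distrib]

/-- **THE ROOT IDENTITY.**  Host `x ∥ 𝓔` (`x = ab` the root between the poles of `𝓔`; `y = u_y v_y`, `z = u_z v_z` the other specials;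
cell `M ∪ {x,y,z}` free, `C` contracted; `x, y, z` pairwise distinct and off `M ∪ C`), `g` blind to `x, y, z`.  Then the level-`J` partial sum of
the antipodal form of `maj₃` against `g` is `−Mt (realEnv M C a b y z) ĝ ĝ (J+1)`, `ĝ(β) = g(β ∪ C) − g((M \ β) ∪ C)`.
[cite: Grimmett2006, §1.4 eq. (1.20) (p. 15); §3.8 (pp. 61–62)] -/
theorem host_root_identity (hxM : s(a, b) ∉ M) (hyM : s(uy, vy) ∉ M) (hzM : s(uz, vz) ∉ M)
    (hxC : s(a, b) ∉ C) (hyC : s(uy, vy) ∉ C) (hzC : s(uz, vz) ∉ C)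
    (hxy : s(a, b) ≠ s(uy, vy)) (hxz : s(a, b) ≠ s(uz, vz)) (hyz : s(uy, vy) ≠ s(uz, vz))
    {g : Finset (Sym2 V) → ℝ} (hgx : ∀ A : Finset (Sym2 V), g (insert s(a, b) A) = g A)
    (hgy : ∀ A : Finset (Sym2 V), g (insert s(uy, vy) A) = g A) (hgz : ∀ A : Finset (Sym2 V), g (insert s(uz, vz) A) = g A) (J : ℕ) :
    ∑ γ ∈ (insert s(a, b) (insert s(uy, vy) (insert s(uz, vz) M))).powerset,
        (if apExpC (insert s(a, b) (insert s(uy, vy) (insert s(uz, vz) M))) C γ ≤ J then (1 : ℝ) else 0) *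
          ((((fun X : Finset (Sym2 V) => if (s(a, b) ∈ X ∧ s(uy, vy) ∈ X) ∨ (s(a, b) ∈ X ∧ s(uz, vz) ∈ X) ∨
              (s(uy, vy) ∈ X ∧ s(uz, vz) ∈ X) then (1 : ℝ) else 0) (γ ∪ C)) -
            ((fun X : Finset (Sym2 V) => if (s(a, b) ∈ X ∧ s(uy, vy) ∈ X) ∨ (s(a, b) ∈ X ∧ s(uz, vz) ∈ X) ∨
              (s(uy, vy) ∈ X ∧ s(uz, vz) ∈ X) then (1 : ℝ) else 0)
                ((insert s(a, b) (insert s(uy, vy) (insert s(uz, vz) M))) \ γ ∪ C))) *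
            (g (γ ∪ C) - g ((insert s(a, b) (insert s(uy, vy) (insert s(uz, vz) M))) \ γ ∪ C))) =
      - Mt (realEnv M C a b s(uy, vy) s(uz, vz)) (fun β => g (β.1 ∪ C) - g (M \ β.1 ∪ C)) (fun β => g (β.1 ∪ C) - g (M \ β.1 ∪ C))
          ((J : ℤ) + 1) := by
  have hyM1 : s(uy, vy) ∉ insert s(uz, vz) M := by rw [Finset.mem_insert, not_or]; exact ⟨hyz, hyM⟩
  have hxM2 : s(a, b) ∉ insert s(uy, vy) (insert s(uz, vz) M) := by
    rw [Finset.mem_insert, not_or, Finset.mem_insert, not_or]; exact ⟨hxy, hxz, hxM⟩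
  rw [sum_powerset_insert₃ hxM2 hyM1 hzM, Mt_self, ← Finset.sum_neg_distrib, ← Finset.sum_coe_sort]
  refine Finset.sum_congr rfl fun β _ => ?_
  obtain ⟨X, hX⟩ := β
  have hXM : X ⊆ M := Finset.mem_powerset.1 hX
  have hxX : s(a, b) ∉ X := fun h => hxM (hXM h)
  have hyX : s(uy, vy) ∉ X := fun h => hyM (hXM h)
  have hzX : s(uz, vz) ∉ X := fun h => hzM (hXM h)
  -- the four patterns as subsets of `M ∪ {y,z}`
  have p0 : X ⊆ insert s(uy, vy) (insert s(uz, vz) M) := hXM.trans ((Finset.subset_insert _ _).trans (Finset.subset_insert _ _))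
  have pz : insert s(uz, vz) X ⊆ insert s(uy, vy) (insert s(uz, vz) M) :=
    (Finset.insert_subset_insert _ hXM).trans (Finset.subset_insert _ _)
  have py : insert s(uy, vy) X ⊆ insert s(uy, vy) (insert s(uz, vz) M) :=
    Finset.insert_subset_insert _ (hXM.trans (Finset.subset_insert _ _))
  have pyz : insert s(uy, vy) (insert s(uz, vz) X) ⊆ insert s(uy, vy) (insert s(uz, vz) M) :=
    Finset.insert_subset_insert _ (Finset.insert_subset_insert _ hXM)
  -- the root edge's level bookkeeping, eight times
  have k10 := apExpC_insert_root_live₁ (C := C) (γ := X) hxM2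
  have k1z := apExpC_insert_root_live₁ (C := C) (γ := insert s(uz, vz) X) hxM2
  have k1y := apExpC_insert_root_live₁ (C := C) (γ := insert s(uy, vy) X) hxM2
  have k1yz := apExpC_insert_root_live₁ (C := C) (γ := insert s(uy, vy) (insert s(uz, vz) X)) hxM2
  have k20 := apExpC_insert_root_live₂ (C := C) hxM2 p0
  have k2z := apExpC_insert_root_live₂ (C := C) hxM2 pz
  have k2y := apExpC_insert_root_live₂ (C := C) hxM2 py
  have k2yz := apExpC_insert_root_live₂ (C := C) hxM2 pyz
  simp only [root_le_iff k10, root_le_iff k1z, root_le_iff k1y, root_le_iff k1yz, root_le_iff k20, root_le_iff k2z,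
    root_le_iff k2y, root_le_iff k2yz]
  -- unfold the right-hand side and normalise both sides
  simp only [realEnv, realPDat, EDat.slot_sum, PDat.a1, PDat.a2, bit, ind, reachB, decide_eq_true_eq,
    Finset.mem_union, Finset.mem_insert, Finset.mem_sdiff, Finset.insert_sdiff_insert, Finset.sdiff_insert_of_notMem,
    Finset.insert_sdiff_of_notMem, Finset.insert_union, hgx, hgy, hgz,
    hxy, hxz, hyz, hxy.symm, hxz.symm, hyz.symm, hxX, hyX, hzX, hxM, hyM, hzM, hxC, hyC, hzC,
    or_true, or_false, and_true, and_false, if_true, if_false, not_false_iff]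
  ring

/-- **THEOREM (the `q`-free `maj₃` inequality of a host from fact 1 of its environment).**  Host `x ∥ 𝓔` as in
`host_root_identity`; if the root functional of the real environment of `𝓔` is nonnegative against every monotone nonnegative weight
(`M_𝓔(h; J) = Mt (realEnv M C a b y z) h h J ≥ 0` — fact 1 of the word theorem), then for every increasing `g` blind to `x, y, z` and every
level `J`, the level-`J` partial sum of the antipodal form of `maj₃(ω_x,ω_y,ω_z)` against `g` on the cell `(M ∪ {x,y,z}, C)` is `≤ 0`:
every coefficient — in the edge odds and in `q` — of `Z_H(z,q)² Cov_{φ_{z,q}}(maj₃, g)/(q−1)` on this cell is nonnegative.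
[cite: Grimmett2006, §1.4 eq. (1.20) (p. 15); §3.8 (pp. 61–62)] [cite: Wagner2006, Thm. 5.8(d), §5.3] -/
theorem maj3_levels_le_nonpos_of_rootFact (hxM : s(a, b) ∉ M) (hyM : s(uy, vy) ∉ M) (hzM : s(uz, vz) ∉ M)
    (hxC : s(a, b) ∉ C) (hyC : s(uy, vy) ∉ C) (hzC : s(uz, vz) ∉ C)
    (hxy : s(a, b) ≠ s(uy, vy)) (hxz : s(a, b) ≠ s(uz, vz)) (hyz : s(uy, vy) ≠ s(uz, vz))
    (hfact : ∀ h : ↥M.powerset → ℝ, Monotone h → (∀ β, 0 ≤ h β) → ∀ J : ℤ, 0 ≤ Mt (realEnv M C a b s(uy, vy) s(uz, vz)) h h J)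
    {g : Finset (Sym2 V) → ℝ} (hgx : ∀ A : Finset (Sym2 V), g (insert s(a, b) A) = g A)
    (hgy : ∀ A : Finset (Sym2 V), g (insert s(uy, vy) A) = g A) (hgz : ∀ A : Finset (Sym2 V), g (insert s(uz, vz) A) = g A)
    (hmono : ∀ ⦃X Y : Finset (Sym2 V)⦄, X ⊆ Y → g X ≤ g Y) (J : ℕ) :
    ∑ γ ∈ (insert s(a, b) (insert s(uy, vy) (insert s(uz, vz) M))).powerset with
        apExpC (insert s(a, b) (insert s(uy, vy) (insert s(uz, vz) M))) C γ ≤ J,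
        ((((fun X : Finset (Sym2 V) => if (s(a, b) ∈ X ∧ s(uy, vy) ∈ X) ∨ (s(a, b) ∈ X ∧ s(uz, vz) ∈ X) ∨
              (s(uy, vy) ∈ X ∧ s(uz, vz) ∈ X) then (1 : ℝ) else 0) (γ ∪ C)) -
            ((fun X : Finset (Sym2 V) => if (s(a, b) ∈ X ∧ s(uy, vy) ∈ X) ∨ (s(a, b) ∈ X ∧ s(uz, vz) ∈ X) ∨
              (s(uy, vy) ∈ X ∧ s(uz, vz) ∈ X) then (1 : ℝ) else 0)
                ((insert s(a, b) (insert s(uy, vy) (insert s(uz, vz) M))) \ γ ∪ C))) *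
          (g (γ ∪ C) - g ((insert s(a, b) (insert s(uy, vy) (insert s(uz, vz) M))) \ γ ∪ C))) ≤ 0 := by
  have key := host_root_identity (C := C) hxM hyM hzM hxC hyC hzC hxy hxz hyz hgx hgy hgz J
  have hpos := hfact (fun β => (g (β.1 ∪ C) - g (M \ β.1 ∪ C)) + (g (M ∪ C) - g C))
    (fun β β' hle => add_le_add_left (incr_mono hmono M C hle) _)
    (fun β => by
      have h1 : g C ≤ g (β.1 ∪ C) := hmono Finset.subset_union_right
      have h2 : g (M \ β.1 ∪ C) ≤ g (M ∪ C) := hmono (Finset.union_subset_union Finset.sdiff_subset le_rfl)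
      linarith) ((J : ℤ) + 1)
  rw [Mt_realEnv_add_const hyM hzM hyz] at hpos
  rw [Finset.sum_filter]
  have hsum : ∀ (S : Finset (Finset (Sym2 V))) (lev : Finset (Sym2 V) → ℕ) (F : Finset (Sym2 V) → ℝ),
      ∑ γ ∈ S, (if lev γ ≤ J then F γ else 0) = ∑ γ ∈ S, (if lev γ ≤ J then (1 : ℝ) else 0) * F γ :=
    fun S lev F => Finset.sum_congr rfl fun γ _ => by split_ifs <;> ring
  rw [hsum, key]
  linarith

end RootIdentity

end RootForm

end FK

end Summit.CriticalPhenomena.PercolationContinuityZ3.Theorems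

end
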